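import Summits.ValiantsHypothesis.ValiantsHypothesis.Theorems.PolyaContinuedSignedCoverLittleBijection
import Literature.Combinatorics.SimpleGraph.MatchingMinorCentral
import Literature.Combinatorics.SimpleGraph.LittleTheoremReduction
import Literature.Combinatorics.SimpleGraph.PfaffianIsomorphism
import HarnessLib

/-!
# Route PolyaContinued — support item `SignedCoverLittle` (stmt-ValiantsHypothesis-7426):
# the E-side chain — DRIVER (stub `stub_chain` of line `even_induction`, from four section specs)

The crux line `Cruxes/SignedCoverLittle/Lines/even_induction.lean` (lead: seat val-width-7426-p1)
reduces the item to `stub_chain`: *a non-Pfaffian target `E` of a label identity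
`Σ_{σ ⊆ H} Π X (φ (i, σ i)) = PM_E` reduces, for a SUBGRAPH `H₁ ⊆ H`, to a label identity onto a
relabelling `relabel (K_{3,3} ⊔ diagonal) ρ κ` of the standard target* (the H-side,
`signedCoverLittle_of_chain` of `…SignedCoverLittleStubEven.lean`, then closes the item).

This file is the DRIVER of that reduction: strong induction on `E.card`, with the four section
lemmas of the port (seats p2/p3/p4) taken as explicitly quantified hypotheses, so that the final
`stub_chain` is a five-line application once they land:

* `hSB`  (p4, same-board bicontraction / fold): a row `a` with exactly two cells `(a,b₀), (a,b₁)` and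
  no other row meeting both columns folds to a target with fewer cells, the same Pfaffian status, and
  the label identity transported by a relabelling `ψ` of the cells;
* `hNP`  (p2): in a deletion-minimal non-Pfaffian target such a row has no parallel row;
* `hT`   (p2): the label identity transposes (`transposeEdges E`, `Prod.swap ∘ φ`);
* `hBase` (p2/p3): a deletion-minimal non-Pfaffian target without a line of exactly two cells IS a
  relabelled standard target.

Driver (`labelIdentity_chain_of`): if some `E.erase e` is non-Pfaffian, restrict
(`labelIdentity_restrict`, `H` shrinks) and recurse; else `E` is deletion-minimal: a two-cell row
folds (`hNP`, `hSB`; `H` fixed, card drops) and we recurse; a two-cell column is a two-cell row of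
`transposeEdges E` (`hT`; no transposing back is needed since the conclusion only asks for SOME
relabelled standard target); otherwise `hBase` ends the chain with `H₁ = H`.
-/

noncomputable section

namespace Summit.ValiantsHypothesis.PolyaContinued

open MvPolynomial Finset Literature.Combinatorics.SimpleGraph Equiv

variable {n : ℕ}

/-- Transposition preserves Pfaffian-ness (both directions). [folklore] -/
theorem isPfaffianBipartite_transposeEdges_iff (E : Finset (Fin n × Fin n)) :
    IsPfaffianBipartite (transposeEdges E) ↔ IsPfaffianBipartite E :=
  (isIsomorphic_transposeEdges E).isPfaffianBipartite_iff.symm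

/-- Deletion-minimality transposes. [folklore] -/
theorem deletionMinimal_transposeEdges {E : Finset (Fin n × Fin n)}
    (hmin : ∀ e ∈ E, IsPfaffianBipartite (E.erase e)) :
    ∀ e ∈ transposeEdges E, IsPfaffianBipartite ((transposeEdges E).erase e) := by
  intro e he
  rw [mem_transposeEdges_iff] at he
  have h := hmin _ he
  have : (transposeEdges E).erase e = transposeEdges (E.erase (e.2, e.1)) := by
    rw [transposeEdges_erase]
  rw [this, isPfaffianBipartite_transposeEdges_iff]
  exact h

/-- A column of `E` is a row of `transposeEdges E`. [folklore] -/
theorem row_transposeEdges_iff (E : Finset (Fin n × Fin n)) (a c : Fin n) :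
    (a, c) ∈ transposeEdges E ↔ (c, a) ∈ E :=
  mem_transposeEdges_iff E (a, c)

/-- A line with exactly two cells: its cells are two distinct positions and nothing else.
[folklore] -/
theorem exists_two_of_card_row_eq_two {E : Finset (Fin n × Fin n)} {a : Fin n}
    (h : (E.filter fun c : Fin n × Fin n => c.1 = a).card = 2) :
    ∃ b₀ b₁ : Fin n, b₀ ≠ b₁ ∧ ∀ c, (a, c) ∈ E ↔ c = b₀ ∨ c = b₁ := by
  obtain ⟨x, y, hxy, hxy'⟩ := Finset.card_eq_two.1 h
  refine ⟨x.2, y.2, ?_, ?_⟩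
  · intro hc
    have hx : x ∈ E.filter fun c : Fin n × Fin n => c.1 = a := by rw [hxy']; simp
    have hy : y ∈ E.filter fun c : Fin n × Fin n => c.1 = a := by rw [hxy']; simp
    rw [Finset.mem_filter] at hx hy
    exact hxy (Prod.ext (hx.2.trans hy.2.symm) hc)
  · intro c
    have key : (a, c) ∈ E ↔ (a, c) ∈ E.filter fun c : Fin n × Fin n => c.1 = a := by
      simp [Finset.mem_filter]
    rw [key, hxy', Finset.mem_insert, Finset.mem_singleton]
    have hx : x ∈ E.filter fun c : Fin n × Fin n => c.1 = a := by rw [hxy']; simp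
    have hy : y ∈ E.filter fun c : Fin n × Fin n => c.1 = a := by rw [hxy']; simp
    rw [Finset.mem_filter] at hx hy
    constructor
    · rintro (h | h)
      · left; rw [← h]
      · right; rw [← h]
    · rintro (h | h)
      · left; exact Prod.ext hx.2.symm (by rw [h])
      · right; exact Prod.ext hy.2.symm (by rw [h])

/-- The column version: a column with exactly two cells of `E` is a row with exactly two cells of
`transposeEdges E`. [folklore] -/
theorem card_row_transposeEdges_eq {E : Finset (Fin n × Fin n)} (j : Fin n) :
    ((transposeEdges E).filter fun c : Fin n × Fin n => c.1 = j).card =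
      (E.filter fun c : Fin n × Fin n => c.2 = j).card := by
  refine Finset.card_bij (fun c _ => (c.2, c.1)) ?_ ?_ ?_
  · intro c hc
    rw [Finset.mem_filter, mem_transposeEdges_iff] at hc
    exact Finset.mem_filter.2 ⟨hc.1, hc.2⟩
  · intro c _ c' _ h
    simp only [Prod.mk.injEq] at h
    exact Prod.ext h.2 h.1
  · intro c hc
    rw [Finset.mem_filter] at hc
    refine ⟨(c.2, c.1), ?_, rfl⟩
    rw [Finset.mem_filter, mem_transposeEdges_iff]
    exact ⟨hc.1, hc.2⟩

/-- **The driver of the E-side chain.** From the four section specs (fold `hSB`, no-parallel `hNP`,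
transpose `hT`, base `hBase`): every non-Pfaffian target of a label identity reduces, for a
subgraph of the source, to a label identity onto a relabelled standard target
`relabel (K_{3,3} ⊔ diagonal) ρ κ`. Strong induction on `E.card`. [folklore] -/
theorem labelIdentity_chain_of
    (hSB : ∀ (E : Finset (Fin n × Fin n)) (a b₀ b₁ : Fin n), b₀ ≠ b₁ →
      (∀ c, (a, c) ∈ E ↔ c = b₀ ∨ c = b₁) →
      (∀ r, r ≠ a → ¬ ((r, b₀) ∈ E ∧ (r, b₁) ∈ E)) →
      ∃ (E₂ : Finset (Fin n × Fin n)) (ψ : Fin n × Fin n → Fin n × Fin n),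
        E₂.card < E.card ∧ (IsPfaffianBipartite E₂ ↔ IsPfaffianBipartite E) ∧
        ∀ (H : Finset (Fin n × Fin n)) (φ : Fin n × Fin n → Fin n × Fin n),
          (∑ σ : Perm (Fin n), if (∀ i, (i, σ i) ∈ H) then
              ∏ i, (X (φ (i, σ i)) : MvPolynomial (Fin n × Fin n) ℂ) else 0) =
            perfectMatchingPoly E ℂ →
          (∑ σ : Perm (Fin n), if (∀ i, (i, σ i) ∈ H) then
              ∏ i, (X (ψ (φ (i, σ i))) : MvPolynomial (Fin n × Fin n) ℂ) else 0) =
            perfectMatchingPoly E₂ ℂ)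
    (hNP : ∀ (E : Finset (Fin n × Fin n)) (a b₀ b₁ : Fin n), ¬ IsPfaffianBipartite E →
      (∀ e ∈ E, IsPfaffianBipartite (E.erase e)) → b₀ ≠ b₁ →
      (∀ c, (a, c) ∈ E ↔ c = b₀ ∨ c = b₁) →
      ∀ r, r ≠ a → ¬ ((r, b₀) ∈ E ∧ (r, b₁) ∈ E))
    (hT : ∀ (H E : Finset (Fin n × Fin n)) (φ : Fin n × Fin n → Fin n × Fin n),
      (∑ σ : Perm (Fin n), if (∀ i, (i, σ i) ∈ H) then
          ∏ i, (X (φ (i, σ i)) : MvPolynomial (Fin n × Fin n) ℂ) else 0) =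
        perfectMatchingPoly E ℂ →
      (∑ σ : Perm (Fin n), if (∀ i, (i, σ i) ∈ H) then
          ∏ i, (X (Prod.swap (φ (i, σ i))) : MvPolynomial (Fin n × Fin n) ℂ) else 0) =
        perfectMatchingPoly (transposeEdges E) ℂ)
    (hBase : ∀ (E : Finset (Fin n × Fin n)), ¬ IsPfaffianBipartite E →
      (∀ e ∈ E, IsPfaffianBipartite (E.erase e)) →
      (∀ i, (E.filter fun c : Fin n × Fin n => c.1 = i).card ≠ 2) →
      (∀ j, (E.filter fun c : Fin n × Fin n => c.2 = j).card ≠ 2) →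
      ∃ ρ κ : Perm (Fin n), E = relabel (Finset.univ.filter fun e : Fin n × Fin n =>
        ((e.1 : ℕ) < 3 ∧ (e.2 : ℕ) < 3) ∨ (e.1 = e.2 ∧ 3 ≤ (e.1 : ℕ))) ρ κ) :
    ∀ (H E : Finset (Fin n × Fin n)) (φ : Fin n × Fin n → Fin n × Fin n),
      (∑ σ : Perm (Fin n), if (∀ i, (i, σ i) ∈ H) then
          ∏ i, (X (φ (i, σ i)) : MvPolynomial (Fin n × Fin n) ℂ) else 0) = perfectMatchingPoly E ℂ →
      ¬ IsPfaffianBipartite E →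
      ∃ (H₁ : Finset (Fin n × Fin n)) (φ₁ : Fin n × Fin n → Fin n × Fin n) (ρ κ : Perm (Fin n)),
        H₁ ⊆ H ∧
        (∑ σ : Perm (Fin n), if (∀ i, (i, σ i) ∈ H₁) then
            ∏ i, (X (φ₁ (i, σ i)) : MvPolynomial (Fin n × Fin n) ℂ) else 0) =
          perfectMatchingPoly (relabel (Finset.univ.filter fun e : Fin n × Fin n =>
            ((e.1 : ℕ) < 3 ∧ (e.2 : ℕ) < 3) ∨ (e.1 = e.2 ∧ 3 ≤ (e.1 : ℕ))) ρ κ) ℂ := by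
  classical
  -- strong induction on the number of cells of the target
  suffices key : ∀ (N : ℕ) (H E : Finset (Fin n × Fin n)) (φ : Fin n × Fin n → Fin n × Fin n),
      E.card ≤ N →
      (∑ σ : Perm (Fin n), if (∀ i, (i, σ i) ∈ H) then
          ∏ i, (X (φ (i, σ i)) : MvPolynomial (Fin n × Fin n) ℂ) else 0) = perfectMatchingPoly E ℂ →
      ¬ IsPfaffianBipartite E →
      ∃ (H₁ : Finset (Fin n × Fin n)) (φ₁ : Fin n × Fin n → Fin n × Fin n) (ρ κ : Perm (Fin n)),
        H₁ ⊆ H ∧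
        (∑ σ : Perm (Fin n), if (∀ i, (i, σ i) ∈ H₁) then
            ∏ i, (X (φ₁ (i, σ i)) : MvPolynomial (Fin n × Fin n) ℂ) else 0) =
          perfectMatchingPoly (relabel (Finset.univ.filter fun e : Fin n × Fin n =>
            ((e.1 : ℕ) < 3 ∧ (e.2 : ℕ) < 3) ∨ (e.1 = e.2 ∧ 3 ≤ (e.1 : ℕ))) ρ κ) ℂ from
    fun H E φ hid hE => key E.card H E φ le_rfl hid hE
  intro N
  induction N with
  | zero =>
    intro H E φ hcard _ hE
    -- an empty target is Pfaffian
    have hE0 : E = ∅ := Finset.card_eq_zero.1 (Nat.le_zero.1 hcard)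
    exfalso
    apply hE
    rw [hE0]
    rcases Nat.eq_zero_or_pos n with hn | hn
    · subst hn
      exact ⟨fun _ => 1, fun τ _ => by simp [Subsingleton.elim τ 1]⟩
    · haveI : Nonempty (Fin n) := ⟨⟨0, hn⟩⟩
      exact isPfaffianBipartite_empty
  | succ N ih =>
    intro H E φ hcard hid hE
    by_cases hmin : ∀ e ∈ E, IsPfaffianBipartite (E.erase e)
    · -- `E` is deletion-minimal
      by_cases hrow : ∃ a, (E.filter fun c : Fin n × Fin n => c.1 = a).card = 2
      · -- a row with exactly two cells: fold
        obtain ⟨a, ha⟩ := hrow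
        obtain ⟨b₀, b₁, hb, hrowE⟩ := exists_two_of_card_row_eq_two ha
        have hnp := hNP E a b₀ b₁ hE hmin hb hrowE
        obtain ⟨E₂, ψ, hlt, hiff, htrans⟩ := hSB E a b₀ b₁ hb hrowE hnp
        have hE₂ : ¬ IsPfaffianBipartite E₂ := fun h => hE (hiff.1 h)
        obtain ⟨H₁, φ₁, ρ, κ, hsub, hid₁⟩ :=
          ih H E₂ (ψ ∘ φ) (by omega) (htrans H φ hid) hE₂
        exact ⟨H₁, φ₁, ρ, κ, hsub, hid₁⟩
      · by_cases hcol : ∃ j, (E.filter fun c : Fin n × Fin n => c.2 = j).card = 2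
        · -- a column with exactly two cells: transpose, then fold
          obtain ⟨j, hj⟩ := hcol
          have hidT := hT H E φ hid
          have hET : ¬ IsPfaffianBipartite (transposeEdges E) := by
            rwa [isPfaffianBipartite_transposeEdges_iff]
          have hminT := deletionMinimal_transposeEdges hmin
          have hjT : ((transposeEdges E).filter fun c : Fin n × Fin n => c.1 = j).card = 2 := by
            rw [card_row_transposeEdges_eq, hj]
          obtain ⟨b₀, b₁, hb, hrowE⟩ := exists_two_of_card_row_eq_two hjT
          have hnp := hNP (transposeEdges E) j b₀ b₁ hET hminT hb hrowE
          obtain ⟨E₂, ψ, hlt, hiff, htrans⟩ := hSB (transposeEdges E) j b₀ b₁ hb hrowE hnp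
          have hE₂ : ¬ IsPfaffianBipartite E₂ := fun h => hET (hiff.1 h)
          have hlt' : E₂.card ≤ N := by
            rw [card_transposeEdges] at hlt; omega
          obtain ⟨H₁, φ₁, ρ, κ, hsub, hid₁⟩ :=
            ih H E₂ (ψ ∘ (Prod.swap ∘ φ)) hlt' (htrans H (Prod.swap ∘ φ) hidT) hE₂
          exact ⟨H₁, φ₁, ρ, κ, hsub, hid₁⟩
        · -- no two-cell line: base case, `E` is a relabelled standard target
          have hr : ∀ i, (E.filter fun c : Fin n × Fin n => c.1 = i).card ≠ 2 :=
            fun i h => hrow ⟨i, h⟩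
          have hc : ∀ j, (E.filter fun c : Fin n × Fin n => c.2 = j).card ≠ 2 :=
            fun j h => hcol ⟨j, h⟩
          obtain ⟨ρ, κ, hEq⟩ := hBase E hE hmin hr hc
          refine ⟨H, φ, ρ, κ, Finset.Subset.refl _, ?_⟩
          rw [← hEq]; exact hid
    · -- not deletion-minimal: restrict to `E.erase e` and recurse
      push Not at hmin
      obtain ⟨e, he, hEe⟩ := hmin
      have hsub : E.erase e ⊆ E := Finset.erase_subset _ _
      have hid' := labelIdentity_restrict (H := H) (φ := φ) hsub hid
      have hlt : (E.erase e).card ≤ N := by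
        rw [Finset.card_erase_of_mem he]; omega
      obtain ⟨H₁, φ₁, ρ, κ, hsub₁, hid₁⟩ := ih _ _ φ hlt hid' hEe
      exact ⟨H₁, φ₁, ρ, κ, hsub₁.trans (Finset.filter_subset _ _), hid₁⟩

end Summit.ValiantsHypothesis.PolyaContinued
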